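import Mathlib
import Literature.NumberTheory.LFunctions.FractionalPartAutocorrelation
import Literature.Analysis.SpecialFunctions.InvSinSqPartialFractions
import HarnessLib

/-!
# Vasyunin's cotangent formula for the autocorrelation `A(p/q)` of the fractional part (BBLS 2003 Prop. 89) and `A(1) = log 2π − γ` (Prop. 87) — `BBLS2003_prop89`, `BBLS2003_prop87` HOLD (re-homed proofs)

**Vasyunin's formula for the multiplicative autocorrelation of the fractional part, `A(λ) = ∫_0^∞ {t}{λt} dt/t²`:
for coprime positive integers `p, q` and `λ = p/q`, `A(λ) = (1−λ)/2 · log λ + (λ+1)/2 · (log 2π − γ) − (π/(2q))·(V(p,q) + V(q,p))`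
with Vasyunin's cotangent sums `V(p,q) = Σ_{k=1}^{q−1} {kp/q} cot(kπ/q)`** — L. Báez-Duarte, M. Balazard, B. Landreau, É. Saias,
*Étude de l'autocorrélation multiplicative de la fonction «partie fractionnaire»*, arXiv:math/0306251 (2003), Prop. 89
[BBLS2003AutocorrelationNotes]; V. I. Vasyunin, *On a biorthogonal system related with the Riemann hypothesis*, St. Petersburg
Math. J. 7 (1996) [Vasyunin1996]; B. Landreau, F. Richard, *Le critère de Beurling et Nyman pour l'hypothèse de Riemann*,
Bull. Soc. Math. France 130 (2002) Thm. 2.1 [LandreauRichard2002] — the closed form behind every entry `G_{ab} = A(a/b)/a` of the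
Nyman–Beurling Gram matrix — and the EXACT discharges `Literature.NumberTheory.LFunctions.BBLS2003_prop89_holds` and (the case
`p = q = 1`) `Literature.NumberTheory.LFunctions.BBLS2003_prop87_holds` (`A(1) = log 2π − γ`, Prop. 87) of the two Literature named
facts of `FractionalPartAutocorrelation.lean`.  RE-HOMED into `Literature/` by the Hodge foundations lane (`lit-hodgefound`, seat
p20, generation 37): verbatim DECLARATION-LEVEL ports, in dependency order and each with its (route-neutralised) module docstring,
of the theorem-only modules `Summits/RiemannHypothesis/RiemannHypothesis/Theorems/{NymanBeurlingVasyuninLayerCake,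
NymanBeurlingVasyuninFiniteIdentity, NymanBeurlingVasyunin (11 declarations; the Gram-matrix corollary stays Summits-side)}.lean`
(cell `pub/rh-li`, where they certified the proof of the data behind the Nyman–Beurling computations), namespace
`Summit.RiemannHypothesis.RiemannHypothesis.Theorems.NbTheory` re-rooted as `Literature.NumberTheory.LFunctions.NymanBeurling`
(sub-namespace `Vasyunin` kept).

PROOF AS FORMALISED (an elementary route — no digamma function, no Gauss multiplication theorem; a deviation of method from the
printed proofs, not of statement; Part headers carry the details): (1) on `(0, M)` the fractional part is a layer cake and
`∫_0^M {px}{qx} x⁻² dx` is a finite sum; (2) inclusion–exclusion on the order of `pk` and `qj` gives the finite master identity,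
then residue re-indexing and the antisymmetrisation `{p(q−r)/q} = 1 − {pr/q}`; (3) Stirling, `H_n − log n → γ` and the cotangent
partial fractions (`Literature/Analysis/SpecialFunctions/InvSinSqPartialFractions.lean`, Mathlib's `cot_series_rep'`) give the limit
`M → ∞`, and `A(p/q) = q⁻¹ ∫_0^∞ {px}{qx} x⁻² dx`.  Theorem-only file: no definition, no new named fact (D-0026); imports
Mathlib/Literature only; every declaration carries the citation of the printed statement it serves.  The only previous proofs were
Summits-side (`…NbTheory.bbls2003_prop89_holds`; for Prop. 87 `…NbTheory.nbGram_zero_zero` via Farey cells), which `Literature/`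
cannot import; the Summits originals stay in place (transitional duplication; twins = same short names).  Classical real analysis;
nothing here bears on `d_N → 0` or on the truth of the Riemann Hypothesis.
-/

noncomputable section

/-!
## Part 1 — port of `Summits/RiemannHypothesis/RiemannHypothesis/Theorems/NymanBeurlingVasyuninLayerCake.lean` (9 declarations kept)

# Vasyunin's formula for the autocorrelation `A(p/q)`, I: `∫_0^M {px}{qx} x⁻² dx` as finite sums (layer cake on `(0, M)`)

The closed form behind every entry of the Nyman–Beurling Gram matrix is Vasyunin's cotangent formula for the BBLS
autocorrelation `A(p/q)` (Báez-Duarte–Balazard–Landreau–Saias, arXiv:math/0306251, Prop. 89; V. I. Vasyunin 1996), typed as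
the NAMED FACT `Literature.NumberTheory.LFunctions.BBLS2003_prop89`.  This Part and the two following ones prove it by an
elementary route (no digamma function, no Gauss multiplication theorem):

1. (this Part) on `(0, M)` the fractional part is a layer cake, `{nx} = nx − Σ_{1≤j<nM} 1[j/n ≤ x]`
   (`fract_mul_eq_sub_sum_step`); expanding `{px}{qx}/x²` and integrating the steps gives
   `∫_0^M {px}{qx} x⁻² dx = pqM − Σ_{k<qM} p log(qM/k) − Σ_{j<pM} q log(pM/j) + Σ_{j,k} (1/max(j/p,k/q) − 1/M)`
   (`integral_fract_mul_fract_eq_sums`), and `Σ_{k<N} log(N/k) = N log N − log N!` (`sum_Ico_mul_log_div`);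
2. (Part 2) the double sum by inclusion–exclusion on the order of `pk` and `qj` — where coprimality and the fractional
   sums `Σ_k {pk/q}/k` enter — giving the FINITE MASTER IDENTITY, then the residue re-indexing and the antisymmetrisation
   `{p(q−r)/q} = 1 − {pr/q}` that produces the cotangent partial fractions;
3. (Part 3) Stirling, `H_n − log n → γ` and `π cot πx = 1/x + Σ (1/(x−n) + 1/(x+n))` give the limit `M → ∞`, and
   `A(p/q) = q⁻¹ ∫_0^∞ {px}{qx} x⁻² dx` gives Prop. 89.

Classical real analysis about the fractional part; nothing here bears on `d_N → 0` or on the truth of RH.  Sources: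
Báez-Duarte–Balazard–Landreau–Saias, arXiv:math/0306251, Prop. 89 [BBLS2003AutocorrelationNotes]; V. I. Vasyunin,
St. Petersburg Math. J. 7 (1996) [Vasyunin1996] (statement); the proof route is the formalisers'.
-/

section Part1

open _root_.MeasureTheory _root_.Set

namespace Literature.NumberTheory.LFunctions.NymanBeurling

open Literature.NumberTheory.LFunctions

namespace Vasyunin

/-! ## Step 1: the fractional part as a layer cake on `(0, M)` -/

/-- For `0 < x < M` and `n ≥ 1`: `{nx} = nx − Σ_{1 ≤ j < nM} 1[j/n ≤ x]` (the sum counts `1 ≤ j ≤ ⌊nx⌋`).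
[cite: BBLS2003AutocorrelationNotes, Prop. 89 (Vasyunin’s formula) — step 1: the layer cake of {nx} on (0, M) and ∫_0^M {px}{qx} x⁻² dx as finite sums] -/
theorem fract_mul_eq_sub_sum_step {n M : ℕ} (hn : 0 < n) {x : ℝ} (hx0 : 0 < x) (hxM : x < M) :
    Int.fract ((n : ℝ) * x) =
      n * x - ∑ j ∈ Finset.Ico 1 (n * M), (if (j : ℝ) / n ≤ x then (1 : ℝ) else 0) := by
  have hn' : (0 : ℝ) < n := by exact_mod_cast hn
  have hnx : 0 ≤ (n : ℝ) * x := by positivity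
  have hiff : ∀ j : ℕ, ((j : ℝ) / n ≤ x ↔ j ≤ ⌊(n : ℝ) * x⌋₊) := by
    intro j
    rw [div_le_iff₀ hn', Nat.le_floor_iff hnx, mul_comm]
  have hfl : ⌊(n : ℝ) * x⌋₊ < n * M := by
    refine (Nat.floor_lt hnx).mpr ?_
    push_cast
    exact mul_lt_mul_of_pos_left hxM hn'
  have hfilter : (Finset.Ico 1 (n * M)).filter (fun j : ℕ => (j : ℝ) / n ≤ x) =
      Finset.Ico 1 (⌊(n : ℝ) * x⌋₊ + 1) := by
    ext j
    simp only [Finset.mem_filter, Finset.mem_Ico, hiff, Nat.lt_succ_iff]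
    constructor
    · rintro ⟨⟨h1, -⟩, hj⟩
      exact ⟨h1, hj⟩
    · rintro ⟨h1, hj⟩
      exact ⟨⟨h1, lt_of_le_of_lt hj hfl⟩, hj⟩
  rw [Finset.sum_ite, Finset.sum_const_zero, add_zero, Finset.sum_const, nsmul_eq_mul, mul_one, hfilter,
    Nat.card_Ico, Nat.add_sub_cancel, natCast_floor_eq_intCast_floor hnx, ← Int.self_sub_floor]

/-- The pointwise expansion of `{px}{qx}/x²` on `(0,M)` into constant, single steps and double steps.
[cite: BBLS2003AutocorrelationNotes, Prop. 89 (Vasyunin’s formula) — step 1: the layer cake of {nx} on (0, M) and ∫_0^M {px}{qx} x⁻² dx as finite sums] -/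
theorem fract_mul_fract_div_sq_eq {p q M : ℕ} (hp : 0 < p) (hq : 0 < q) {x : ℝ} (hx0 : 0 < x) (hxM : x < M) :
    Int.fract ((p : ℝ) * x) * Int.fract ((q : ℝ) * x) / x ^ 2 =
      (p : ℝ) * q
        - ∑ k ∈ Finset.Ico 1 (q * M), (if (k : ℝ) / q ≤ x then (p : ℝ) / x else 0)
        - ∑ j ∈ Finset.Ico 1 (p * M), (if (j : ℝ) / p ≤ x then (q : ℝ) / x else 0)
        + ∑ j ∈ Finset.Ico 1 (p * M), ∑ k ∈ Finset.Ico 1 (q * M),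
            (if max ((j : ℝ) / p) ((k : ℝ) / q) ≤ x then 1 / x ^ 2 else 0) := by
  rw [fract_mul_eq_sub_sum_step hp hx0 hxM, fract_mul_eq_sub_sum_step hq hx0 hxM]
  set A := ∑ j ∈ Finset.Ico 1 (p * M), (if (j : ℝ) / p ≤ x then (1 : ℝ) else 0) with hA
  set B := ∑ k ∈ Finset.Ico 1 (q * M), (if (k : ℝ) / q ≤ x then (1 : ℝ) else 0) with hB
  have hx' : x ≠ 0 := hx0.ne'
  have h1 : ∑ k ∈ Finset.Ico 1 (q * M), (if (k : ℝ) / q ≤ x then (p : ℝ) / x else 0) = p / x * B := by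
    rw [hB, Finset.mul_sum]
    refine Finset.sum_congr rfl fun k _ => ?_
    split_ifs <;> simp
  have h2 : ∑ j ∈ Finset.Ico 1 (p * M), (if (j : ℝ) / p ≤ x then (q : ℝ) / x else 0) = q / x * A := by
    rw [hA, Finset.mul_sum]
    refine Finset.sum_congr rfl fun j _ => ?_
    split_ifs <;> simp
  have h3 : ∑ j ∈ Finset.Ico 1 (p * M), ∑ k ∈ Finset.Ico 1 (q * M),
      (if max ((j : ℝ) / p) ((k : ℝ) / q) ≤ x then 1 / x ^ 2 else 0) = A * B / x ^ 2 := by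
    rw [hA, hB, Finset.sum_mul_sum, Finset.sum_div]
    refine Finset.sum_congr rfl fun j _ => ?_
    rw [Finset.sum_div]
    refine Finset.sum_congr rfl fun k _ => ?_
    by_cases hj : (j : ℝ) / p ≤ x <;> by_cases hk : (k : ℝ) / q ≤ x <;> simp [hj, hk]
  rw [h1, h2, h3]
  field_simp
  ring

/-! ## Step 2: integrating the steps over `(0, M)` -/

/-- `∫_{(0,M)} 1[a ≤ x] h(x) dx = ∫_a^M h` for `0 < a ≤ M`.
[cite: BBLS2003AutocorrelationNotes, Prop. 89 (Vasyunin’s formula) — step 1: the layer cake of {nx} on (0, M) and ∫_0^M {px}{qx} x⁻² dx as finite sums] -/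
theorem setIntegral_Ioo_step {a M : ℝ} (ha : 0 < a) (haM : a ≤ M) (h : ℝ → ℝ) :
    ∫ x in Ioo 0 M, (if a ≤ x then h x else 0) = ∫ x in a..M, h x := by
  have heq : (fun x : ℝ => if a ≤ x then h x else 0) = (Ici a).indicator h := by
    ext x
    simp [Set.indicator_apply, Set.mem_Ici]
  rw [heq, setIntegral_indicator measurableSet_Ici]
  have hset : Ioo 0 M ∩ Ici a = Ico a M := by
    ext x
    simp only [mem_inter_iff, mem_Ioo, mem_Ici, mem_Ico]
    constructor
    · rintro ⟨⟨-, h2⟩, h3⟩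
      exact ⟨h3, h2⟩
    · rintro ⟨h1, h2⟩
      exact ⟨⟨lt_of_lt_of_le ha h1, h2⟩, h1⟩
  rw [hset, integral_Ico_eq_integral_Ioo, ← integral_Ioc_eq_integral_Ioo, intervalIntegral.integral_of_le haM]

/-- Integrability of a step `1[a ≤ x] h(x)` on `(0, M)` for `0 < a` and `h` continuous on `[a, M]`.
[cite: BBLS2003AutocorrelationNotes, Prop. 89 (Vasyunin’s formula) — step 1: the layer cake of {nx} on (0, M) and ∫_0^M {px}{qx} x⁻² dx as finite sums] -/
theorem integrableOn_Ioo_step {a M : ℝ} (ha : 0 < a) {h : ℝ → ℝ} (hh : ContinuousOn h (Icc a M)) :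
    IntegrableOn (fun x : ℝ => if a ≤ x then h x else 0) (Ioo 0 M) := by
  have heq : (fun x : ℝ => if a ≤ x then h x else 0) = (Ici a).indicator h := by
    ext x
    simp [Set.indicator_apply, Set.mem_Ici]
  rw [heq, IntegrableOn, integrable_indicator_iff measurableSet_Ici, IntegrableOn,
    Measure.restrict_restrict measurableSet_Ici]
  have hset : Ici a ∩ Ioo 0 M = Ico a M := by
    ext x
    simp only [mem_inter_iff, mem_Ioo, mem_Ici, mem_Ico]
    constructor
    · rintro ⟨h3, -, h2⟩
      exact ⟨h3, h2⟩
    · rintro ⟨h1, h2⟩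
      exact ⟨h1, lt_of_lt_of_le ha h1, h2⟩
  rw [hset]
  exact (hh.integrableOn_compact isCompact_Icc).mono_set Ico_subset_Icc_self

/-- `∫_a^M c/x dx = c log(M/a)` for `0 < a ≤ M`.
[cite: BBLS2003AutocorrelationNotes, Prop. 89 (Vasyunin’s formula) — step 1: the layer cake of {nx} on (0, M) and ∫_0^M {px}{qx} x⁻² dx as finite sums] -/
theorem integral_const_div {a M : ℝ} (ha : 0 < a) (haM : a ≤ M) (c : ℝ) :
    ∫ x in a..M, c / x = c * Real.log (M / a) := by
  have h0 : (0 : ℝ) ∉ uIcc a M := by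
    rw [uIcc_of_le haM]
    intro h
    exact absurd h.1 (not_le.mpr ha)
  calc ∫ x in a..M, c / x = ∫ x in a..M, c * x⁻¹ := by simp_rw [div_eq_mul_inv]
    _ = c * Real.log (M / a) := by rw [intervalIntegral.integral_const_mul, integral_inv h0]

/-- `∫_a^M dx/x² = 1/a − 1/M` for `0 < a ≤ M`.
[cite: BBLS2003AutocorrelationNotes, Prop. 89 (Vasyunin’s formula) — step 1: the layer cake of {nx} on (0, M) and ∫_0^M {px}{qx} x⁻² dx as finite sums] -/
theorem integral_one_div_sq {a M : ℝ} (ha : 0 < a) (haM : a ≤ M) :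
    ∫ x in a..M, 1 / x ^ 2 = 1 / a - 1 / M := by
  have hderiv : ∀ x ∈ uIcc a M, HasDerivAt (fun y : ℝ => -y⁻¹) (1 / x ^ 2) x := by
    intro x hx
    rw [uIcc_of_le haM] at hx
    have hx0 : x ≠ 0 := (lt_of_lt_of_le ha hx.1).ne'
    have h := (hasDerivAt_inv hx0).neg
    refine h.congr_deriv ?_
    field_simp
  have hint : IntervalIntegrable (fun x : ℝ => 1 / x ^ 2) volume a M := by
    refine (continuousOn_of_forall_continuousAt fun x hx => ?_).intervalIntegrable
    rw [uIcc_of_le haM] at hx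
    have hx0 : x ≠ 0 := (lt_of_lt_of_le ha hx.1).ne'
    have hx2 : x ^ 2 ≠ 0 := pow_ne_zero 2 hx0
    fun_prop (disch := assumption)
  rw [intervalIntegral.integral_eq_sub_of_hasDerivAt hderiv hint]
  have hM0 : M ≠ 0 := (lt_of_lt_of_le ha haM).ne'
  have ha0 : a ≠ 0 := ha.ne'
  field_simp
  ring

/-- The integral of `{px}{qx}/x²` over `(0, M)` in terms of finite sums (before any simplification).
[cite: BBLS2003AutocorrelationNotes, Prop. 89 (Vasyunin’s formula) — step 1: the layer cake of {nx} on (0, M) and ∫_0^M {px}{qx} x⁻² dx as finite sums] -/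
theorem integral_fract_mul_fract_eq_sums {p q M : ℕ} (hp : 0 < p) (hq : 0 < q) (hM : 0 < M) :
    ∫ x in (0 : ℝ)..M, Int.fract ((p : ℝ) * x) * Int.fract ((q : ℝ) * x) / x ^ 2 =
      (p : ℝ) * q * M
        - ∑ k ∈ Finset.Ico 1 (q * M), (p : ℝ) * Real.log (M / ((k : ℝ) / q))
        - ∑ j ∈ Finset.Ico 1 (p * M), (q : ℝ) * Real.log (M / ((j : ℝ) / p))
        + ∑ j ∈ Finset.Ico 1 (p * M), ∑ k ∈ Finset.Ico 1 (q * M),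
            (1 / max ((j : ℝ) / p) ((k : ℝ) / q) - 1 / M) := by
  have hM' : (0 : ℝ) < M := by exact_mod_cast hM
  have hp' : (0 : ℝ) < p := by exact_mod_cast hp
  have hq' : (0 : ℝ) < q := by exact_mod_cast hq
  -- thresholds lie in (0, M]
  have hk_pos : ∀ k ∈ Finset.Ico 1 (q * M), (0 : ℝ) < (k : ℝ) / q := by
    intro k hk
    rw [Finset.mem_Ico] at hk
    have : (1 : ℝ) ≤ k := by exact_mod_cast hk.1
    positivity
  have hk_le : ∀ k ∈ Finset.Ico 1 (q * M), (k : ℝ) / q ≤ M := by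
    intro k hk
    rw [Finset.mem_Ico] at hk
    rw [div_le_iff₀ hq']
    have : (k : ℝ) < (q * M : ℕ) := by exact_mod_cast hk.2
    push_cast at this
    linarith
  have hj_pos : ∀ j ∈ Finset.Ico 1 (p * M), (0 : ℝ) < (j : ℝ) / p := by
    intro j hj
    rw [Finset.mem_Ico] at hj
    have : (1 : ℝ) ≤ j := by exact_mod_cast hj.1
    positivity
  have hj_le : ∀ j ∈ Finset.Ico 1 (p * M), (j : ℝ) / p ≤ M := by
    intro j hj
    rw [Finset.mem_Ico] at hj
    rw [div_le_iff₀ hp']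
    have : (j : ℝ) < (p * M : ℕ) := by exact_mod_cast hj.2
    push_cast at this
    linarith
  have hcont1 : ∀ (a c : ℝ), 0 < a → ContinuousOn (fun x : ℝ => c / x) (Icc a M) := by
    intro a c ha
    refine continuousOn_of_forall_continuousAt fun x hx => ?_
    have hx0 : x ≠ 0 := (lt_of_lt_of_le ha hx.1).ne'
    fun_prop (disch := assumption)
  have hcont2 : ∀ a : ℝ, 0 < a → ContinuousOn (fun x : ℝ => 1 / x ^ 2) (Icc a M) := by
    intro a ha
    refine continuousOn_of_forall_continuousAt fun x hx => ?_
    have hx0 : x ≠ 0 := (lt_of_lt_of_le ha hx.1).ne'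
    have hx2 : x ^ 2 ≠ 0 := pow_ne_zero 2 hx0
    fun_prop (disch := assumption)
  -- pass to the set integral over Ioo 0 M and expand pointwise
  rw [intervalIntegral.integral_of_le hM'.le, integral_Ioc_eq_integral_Ioo,
    setIntegral_congr_fun measurableSet_Ioo (fun x hx => fract_mul_fract_div_sq_eq (M := M) hp hq hx.1 hx.2)]
  -- integrability of the pieces
  have iK : ∀ k ∈ Finset.Ico 1 (q * M),
      IntegrableOn (fun x : ℝ => if (k : ℝ) / q ≤ x then (p : ℝ) / x else 0) (Ioo 0 M) :=
    fun k hk => integrableOn_Ioo_step (hk_pos k hk) (hcont1 _ _ (hk_pos k hk))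
  have iJ : ∀ j ∈ Finset.Ico 1 (p * M),
      IntegrableOn (fun x : ℝ => if (j : ℝ) / p ≤ x then (q : ℝ) / x else 0) (Ioo 0 M) :=
    fun j hj => integrableOn_Ioo_step (hj_pos j hj) (hcont1 _ _ (hj_pos j hj))
  have iJK : ∀ j ∈ Finset.Ico 1 (p * M), ∀ k ∈ Finset.Ico 1 (q * M),
      IntegrableOn (fun x : ℝ => if max ((j : ℝ) / p) ((k : ℝ) / q) ≤ x then 1 / x ^ 2 else 0) (Ioo 0 M) :=
    fun j hj k hk => integrableOn_Ioo_step (lt_max_of_lt_left (hj_pos j hj)) (hcont2 _ (lt_max_of_lt_left (hj_pos j hj)))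
  have iC : IntegrableOn (fun _ : ℝ => (p : ℝ) * q) (Ioo 0 M) := integrableOn_const (by simp)
  have iSK : IntegrableOn (fun x : ℝ => ∑ k ∈ Finset.Ico 1 (q * M),
      (if (k : ℝ) / q ≤ x then (p : ℝ) / x else 0)) (Ioo 0 M) :=
    integrable_finsetSum _ iK
  have iSJ : IntegrableOn (fun x : ℝ => ∑ j ∈ Finset.Ico 1 (p * M),
      (if (j : ℝ) / p ≤ x then (q : ℝ) / x else 0)) (Ioo 0 M) :=
    integrable_finsetSum _ iJ
  have iSJK : IntegrableOn (fun x : ℝ => ∑ j ∈ Finset.Ico 1 (p * M), ∑ k ∈ Finset.Ico 1 (q * M),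
      (if max ((j : ℝ) / p) ((k : ℝ) / q) ≤ x then 1 / x ^ 2 else 0)) (Ioo 0 M) :=
    integrable_finsetSum _ fun j hj => integrable_finsetSum _ fun k hk => iJK j hj k hk
  have i1 : IntegrableOn (fun x : ℝ => (p : ℝ) * q
      - ∑ k ∈ Finset.Ico 1 (q * M), (if (k : ℝ) / q ≤ x then (p : ℝ) / x else 0)) (Ioo 0 M) :=
    iC.sub' iSK
  have i2 : IntegrableOn (fun x : ℝ => (p : ℝ) * q
      - ∑ k ∈ Finset.Ico 1 (q * M), (if (k : ℝ) / q ≤ x then (p : ℝ) / x else 0)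
      - ∑ j ∈ Finset.Ico 1 (p * M), (if (j : ℝ) / p ≤ x then (q : ℝ) / x else 0)) (Ioo 0 M) :=
    i1.sub' iSJ
  rw [integral_add i2 iSJK, integral_sub i1 iSJ, integral_sub iC iSK,
    integral_finsetSum _ iK, integral_finsetSum _ iJ,
    integral_finsetSum _ (fun j hj => integrable_finsetSum _ fun k hk => iJK j hj k hk)]
  -- evaluate each piece
  have eC : ∫ _ in Ioo (0 : ℝ) M, (p : ℝ) * q = (p : ℝ) * q * M := by
    rw [setIntegral_const, Real.volume_real_Ioo_of_le hM'.le, sub_zero, smul_eq_mul]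
    ring
  have eK : ∀ k ∈ Finset.Ico 1 (q * M),
      ∫ x in Ioo (0 : ℝ) M, (if (k : ℝ) / q ≤ x then (p : ℝ) / x else 0) = p * Real.log (M / ((k : ℝ) / q)) := by
    intro k hk
    rw [setIntegral_Ioo_step (hk_pos k hk) (hk_le k hk), integral_const_div (hk_pos k hk) (hk_le k hk)]
  have eJ : ∀ j ∈ Finset.Ico 1 (p * M),
      ∫ x in Ioo (0 : ℝ) M, (if (j : ℝ) / p ≤ x then (q : ℝ) / x else 0) = q * Real.log (M / ((j : ℝ) / p)) := by
    intro j hj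
    rw [setIntegral_Ioo_step (hj_pos j hj) (hj_le j hj), integral_const_div (hj_pos j hj) (hj_le j hj)]
  have eJK : ∀ j ∈ Finset.Ico 1 (p * M), ∀ k ∈ Finset.Ico 1 (q * M),
      ∫ x in Ioo (0 : ℝ) M, (if max ((j : ℝ) / p) ((k : ℝ) / q) ≤ x then 1 / x ^ 2 else 0) =
        1 / max ((j : ℝ) / p) ((k : ℝ) / q) - 1 / M := by
    intro j hj k hk
    have hpos : 0 < max ((j : ℝ) / p) ((k : ℝ) / q) := lt_max_of_lt_left (hj_pos j hj)
    have hle : max ((j : ℝ) / p) ((k : ℝ) / q) ≤ M := max_le (hj_le j hj) (hk_le k hk)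
    rw [setIntegral_Ioo_step hpos hle (fun x : ℝ => 1 / x ^ 2), integral_one_div_sq hpos hle]
  rw [eC, Finset.sum_congr rfl eK, Finset.sum_congr rfl eJ,
    Finset.sum_congr rfl fun j hj => (integral_finsetSum _ fun k hk => iJK j hj k hk).trans
      (Finset.sum_congr rfl fun k hk => eJK j hj k hk)]

/-! ## Step 3: the logarithmic sums -/

/-- `Σ_{1 ≤ k ≤ N} log k = log N!`.
[cite: BBLS2003AutocorrelationNotes, Prop. 89 (Vasyunin’s formula) — step 1: the layer cake of {nx} on (0, M) and ∫_0^M {px}{qx} x⁻² dx as finite sums] -/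
theorem sum_Ico_log_eq_log_factorial (N : ℕ) :
    ∑ k ∈ Finset.Ico 1 (N + 1), Real.log k = Real.log (N.factorial) := by
  induction N with
  | zero => simp
  | succ N ih =>
    rw [Finset.sum_Ico_succ_top (by omega), ih, Nat.factorial_succ, Nat.cast_mul,
      Real.log_mul (by positivity) (by positivity)]
    push_cast
    ring

/-- `Σ_{1 ≤ k < N} c·log(M/(k/n)) = c·(N log N − log N!)` when `n M = N ≥ 1` (the single-step integrals summed).
[cite: BBLS2003AutocorrelationNotes, Prop. 89 (Vasyunin’s formula) — step 1: the layer cake of {nx} on (0, M) and ∫_0^M {px}{qx} x⁻² dx as finite sums] -/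
theorem sum_Ico_mul_log_div {n M : ℕ} (hn : 0 < n) (hM : 0 < M) (c : ℝ) :
    ∑ k ∈ Finset.Ico 1 (n * M), c * Real.log (M / ((k : ℝ) / n)) =
      c * ((n : ℝ) * M * Real.log ((n : ℝ) * M) - Real.log ((n * M).factorial)) := by
  have hn' : (0 : ℝ) < n := by exact_mod_cast hn
  have hM' : (0 : ℝ) < M := by exact_mod_cast hM
  obtain ⟨N, hN⟩ : ∃ N : ℕ, n * M = N + 1 := ⟨n * M - 1, by
    have : 1 ≤ n * M := Nat.one_le_iff_ne_zero.mpr (Nat.mul_ne_zero hn.ne' hM.ne'); omega⟩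
  have hcast : (n : ℝ) * M = (N : ℝ) + 1 := by exact_mod_cast hN
  rw [hN, ← Finset.mul_sum]
  congr 1
  have hterm : ∀ k ∈ Finset.Ico 1 (N + 1), Real.log (M / ((k : ℝ) / n)) = Real.log ((N : ℝ) + 1) - Real.log k := by
    intro k hk
    rw [Finset.mem_Ico] at hk
    have hk0 : (0 : ℝ) < k := by exact_mod_cast hk.1
    rw [← hcast, ← Real.log_div (by positivity) hk0.ne']
    congr 1
    field_simp
  rw [Finset.sum_congr rfl hterm, Finset.sum_sub_distrib, Finset.sum_const, Nat.card_Ico, nsmul_eq_mul,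
    sum_Ico_log_eq_log_factorial, hcast, Nat.factorial_succ, Nat.cast_mul,
    Real.log_mul (by positivity) (by positivity)]
  push_cast
  ring

end Vasyunin

end Literature.NumberTheory.LFunctions.NymanBeurling

end Part1

/-!
## Part 2 — port of `Summits/RiemannHypothesis/RiemannHypothesis/Theorems/NymanBeurlingVasyuninFiniteIdentity.lean` (18 declarations kept)

# Vasyunin's formula, II: the finite master identity

For coprime `p, q ≥ 1` and `M ≥ 1`:

* the double sum `S(M) = Σ_{1≤j<pM} Σ_{1≤k<qM} 1/max(j/p, k/q)` by inclusion–exclusion on the order of `pk` and `qj`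
  (`#{k : pk ≤ qj} = ⌊qj/p⌋`, `⌊a/b⌋ = a/b − {a/b}`, diagonal `pk = qj ⇔ (j,k) = (pm,qm)` by coprimality): `sum_sum_one_div_max_eq`;
* the **finite master identity** `integral_fract_mul_fract_eq`: `∫_0^M {px}{qx} x⁻² dx = 2pqM − p(qM log(qM) − log (qM)!)
  − q(pM log(pM) − log (pM)!) − H_{M−1} − 1/M − qΣ_{k<qM} {pk/q}/k − pΣ_{j<pM} {qj/p}/j`;
* the residue re-indexing `qΣ_{k<qM} {pk/q}/k = Σ_{1≤r<q} {pr/q} Σ_{n<M} q/(qn+r)`, `Σ_{1≤r<q} Σ_{n<M} q/(qn+r) = qH_{qM−1} − H_{M−1}`,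
  and the antisymmetrisation `2Σ_r {pr/q} h(r) = Σ_r h(r) + Σ_r {pr/q}(h(r) − h(q−r))` from `{p(q−r)/q} = 1 − {pr/q}`, whose
  differences `Σ_{n<M} (1/(n + r/q) − 1/(n + 1 − r/q))` are the partial sums of the cotangent series.
-/

section Part2

open _root_.MeasureTheory _root_.Set
namespace Literature.NumberTheory.LFunctions.NymanBeurling

open Literature.NumberTheory.LFunctions
namespace Vasyunin

/-! ## Step 4: the double sum `S(M) = Σ_{j<pM, k<qM} 1/max(j/p, k/q)` -/

/-- Inclusion–exclusion for `1/max(j/p, k/q)` according to the order of `pk` and `qj`.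
[cite: BBLS2003AutocorrelationNotes, Prop. 89 — step 2: the finite master identity (inclusion–exclusion, residue re-indexing, antisymmetrisation)] -/
theorem one_div_max_eq_ite {p q : ℕ} (j k : ℕ) (hp : 0 < p) (hq : 0 < q) :
    1 / max ((j : ℝ) / p) ((k : ℝ) / q) =
      (if p * k ≤ q * j then (p : ℝ) / j else 0) + (if q * j ≤ p * k then (q : ℝ) / k else 0)
        - (if p * k = q * j then (p : ℝ) / j else 0) := by
  have hp' : (0 : ℝ) < p := by exact_mod_cast hp
  have hq' : (0 : ℝ) < q := by exact_mod_cast hq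
  have key : ((k : ℝ) / q ≤ (j : ℝ) / p ↔ p * k ≤ q * j) := by
    rw [div_le_div_iff₀ hq' hp']
    constructor
    · intro h
      have : ((p * k : ℕ) : ℝ) ≤ ((q * j : ℕ) : ℝ) := by push_cast; linarith
      exact_mod_cast this
    · intro h
      have : ((p * k : ℕ) : ℝ) ≤ ((q * j : ℕ) : ℝ) := by exact_mod_cast h
      push_cast at this
      linarith
  have key' : ((j : ℝ) / p ≤ (k : ℝ) / q ↔ q * j ≤ p * k) := by
    rw [div_le_div_iff₀ hp' hq']
    constructor
    · intro h
      have : ((q * j : ℕ) : ℝ) ≤ ((p * k : ℕ) : ℝ) := by push_cast; linarith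
      exact_mod_cast this
    · intro h
      have : ((q * j : ℕ) : ℝ) ≤ ((p * k : ℕ) : ℝ) := by exact_mod_cast h
      push_cast at this
      linarith
  rcases lt_trichotomy (p * k) (q * j) with h | h | h
  · have h1 : p * k ≤ q * j := h.le
    have h2 : ¬ q * j ≤ p * k := not_le.mpr h
    have h3 : p * k ≠ q * j := h.ne
    rw [if_pos h1, if_neg h2, if_neg h3, max_eq_left (key.mpr h1), add_zero, sub_zero, one_div_div]
  · have h1 : p * k ≤ q * j := h.le
    have h2 : q * j ≤ p * k := h.ge
    rw [if_pos h1, if_pos h2, if_pos h, max_eq_right (key'.mpr h2), one_div_div]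
    ring
  · have h1 : ¬ p * k ≤ q * j := not_le.mpr h
    have h2 : q * j ≤ p * k := h.le
    have h3 : p * k ≠ q * j := h.ne'
    rw [if_neg h1, if_pos h2, if_neg h3, max_eq_right (key'.mpr h2), zero_add, sub_zero, one_div_div]

/-- Counting: for `1 ≤ j < pM`, `#{1 ≤ k < qM : pk ≤ qj} = ⌊qj/p⌋`, as a sum.
[cite: BBLS2003AutocorrelationNotes, Prop. 89 — step 2: the finite master identity (inclusion–exclusion, residue re-indexing, antisymmetrisation)] -/
theorem sum_ite_mul_le_eq {p q M j : ℕ} (hp : 0 < p) (hq : 0 < q) (hj : j ∈ Finset.Ico 1 (p * M)) (c : ℝ) :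
    ∑ k ∈ Finset.Ico 1 (q * M), (if p * k ≤ q * j then c else 0) = ((q * j / p : ℕ) : ℝ) * c := by
  rw [Finset.mem_Ico] at hj
  have hlt : q * j / p < q * M := by
    rw [Nat.div_lt_iff_lt_mul hp]
    calc q * j < q * (p * M) := Nat.mul_lt_mul_of_pos_left hj.2 hq
      _ = q * M * p := by ring
  have hfilter : (Finset.Ico 1 (q * M)).filter (fun k => p * k ≤ q * j) = Finset.Ico 1 (q * j / p + 1) := by
    ext k
    simp only [Finset.mem_filter, Finset.mem_Ico, Nat.lt_succ_iff]
    rw [Nat.le_div_iff_mul_le hp, mul_comm k p]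
    constructor
    · rintro ⟨⟨h1, -⟩, h2⟩; exact ⟨h1, h2⟩
    · rintro ⟨h1, h2⟩
      refine ⟨⟨h1, ?_⟩, h2⟩
      have : k ≤ q * j / p := by rw [Nat.le_div_iff_mul_le hp, mul_comm k p]; exact h2
      exact lt_of_le_of_lt this hlt
  rw [← Finset.sum_filter, hfilter, Finset.sum_const, Nat.card_Ico, Nat.add_sub_cancel, nsmul_eq_mul]

/-- `⌊a/b⌋ = a/b − {a/b}` for the natural-number quotient, in `ℝ`.
[cite: BBLS2003AutocorrelationNotes, Prop. 89 — step 2: the finite master identity (inclusion–exclusion, residue re-indexing, antisymmetrisation)] -/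
theorem natCast_div_eq_sub_fract (a : ℕ) {b : ℕ} (hb : 0 < b) :
    ((a / b : ℕ) : ℝ) = (a : ℝ) / b - Int.fract ((a : ℝ) / b) := by
  rw [Int.fract_div_natCast_eq_div_natCast_mod]
  have h := Nat.div_add_mod a b
  have hb' : (b : ℝ) ≠ 0 := by exact_mod_cast hb.ne'
  have hcast : (b : ℝ) * ((a / b : ℕ) : ℝ) + ((a % b : ℕ) : ℝ) = a := by exact_mod_cast h
  field_simp
  linarith

/-- The `pk ≤ qj` part of `S(M)`: `Σ_j Σ_k 1[pk ≤ qj]·p/j = q(pM − 1) − p Σ_j {qj/p}/j`.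
[cite: BBLS2003AutocorrelationNotes, Prop. 89 — step 2: the finite master identity (inclusion–exclusion, residue re-indexing, antisymmetrisation)] -/
theorem sum_sum_ite_le_eq {p q M : ℕ} (hp : 0 < p) (hq : 0 < q) (hM : 0 < M) :
    ∑ j ∈ Finset.Ico 1 (p * M), ∑ k ∈ Finset.Ico 1 (q * M), (if p * k ≤ q * j then (p : ℝ) / j else 0) =
      (q : ℝ) * ((p : ℝ) * M - 1) - p * ∑ j ∈ Finset.Ico 1 (p * M), Int.fract ((q : ℝ) * j / p) / j := by
  have hp' : (p : ℝ) ≠ 0 := by exact_mod_cast hp.ne'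
  have hterm : ∀ j ∈ Finset.Ico 1 (p * M),
      ∑ k ∈ Finset.Ico 1 (q * M), (if p * k ≤ q * j then (p : ℝ) / j else 0) =
        q - p * (Int.fract ((q : ℝ) * j / p) / j) := by
    intro j hj
    rw [sum_ite_mul_le_eq hp hq hj, natCast_div_eq_sub_fract _ hp]
    rw [Finset.mem_Ico] at hj
    have hj' : (j : ℝ) ≠ 0 := by
      have : (1 : ℝ) ≤ j := by exact_mod_cast hj.1
      positivity
    have e : ((q * j : ℕ) : ℝ) / p * ((p : ℝ) / j) = q := by
      push_cast
      field_simp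
    push_cast at e ⊢
    rw [sub_mul, e]
    ring
  rw [Finset.sum_congr rfl hterm, Finset.sum_sub_distrib, Finset.sum_const, Nat.card_Ico, nsmul_eq_mul,
    ← Finset.mul_sum]
  have h1 : 1 ≤ p * M := Nat.one_le_iff_ne_zero.mpr (Nat.mul_ne_zero hp.ne' hM.ne')
  rw [Nat.cast_sub h1]
  push_cast
  ring

/-- Multiples of `p` in `[1, pM)`: `Σ_{1 ≤ j < pM, p ∣ j} f(j) = Σ_{1 ≤ m < M} f(pm)`.
[cite: BBLS2003AutocorrelationNotes, Prop. 89 — step 2: the finite master identity (inclusion–exclusion, residue re-indexing, antisymmetrisation)] -/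
theorem sum_Ico_ite_dvd_eq {p M : ℕ} (hp : 0 < p) (f : ℕ → ℝ) :
    ∑ j ∈ Finset.Ico 1 (p * M), (if p ∣ j then f j else 0) = ∑ m ∈ Finset.Ico 1 M, f (p * m) := by
  rw [← Finset.sum_filter]
  have himage : (Finset.Ico 1 (p * M)).filter (fun j => p ∣ j) = (Finset.Ico 1 M).image (fun m => p * m) := by
    ext j
    simp only [Finset.mem_filter, Finset.mem_Ico, Finset.mem_image]
    constructor
    · rintro ⟨⟨h1, h2⟩, ⟨m, rfl⟩⟩
      refine ⟨m, ⟨?_, ?_⟩, rfl⟩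
      · rcases Nat.eq_zero_or_pos m with h | h
        · subst h; simp at h1
        exact h
      · exact Nat.lt_of_mul_lt_mul_left h2
    · rintro ⟨m, ⟨h1, h2⟩, rfl⟩
      refine ⟨⟨?_, Nat.mul_lt_mul_of_pos_left h2 hp⟩, dvd_mul_right p m⟩
      exact Nat.one_le_iff_ne_zero.mpr (Nat.mul_ne_zero hp.ne' (by omega))
  rw [himage, Finset.sum_image]
  intro a _ b _ hab
  exact Nat.eq_of_mul_eq_mul_left hp hab

/-- The diagonal of `S(M)`: `Σ_j Σ_k 1[pk = qj]·p/j = Σ_{1 ≤ m < M} 1/m` (coprimality: `pk = qj ⇔ (j,k) = (pm,qm)`).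
[cite: BBLS2003AutocorrelationNotes, Prop. 89 — step 2: the finite master identity (inclusion–exclusion, residue re-indexing, antisymmetrisation)] -/
theorem sum_sum_ite_eq_eq {p q M : ℕ} (hp : 0 < p) (hq : 0 < q) (hpq : Nat.Coprime p q) :
    ∑ j ∈ Finset.Ico 1 (p * M), ∑ k ∈ Finset.Ico 1 (q * M), (if p * k = q * j then (p : ℝ) / j else 0) =
      ∑ m ∈ Finset.Ico 1 M, 1 / (m : ℝ) := by
  have hp' : (p : ℝ) ≠ 0 := by exact_mod_cast hp.ne'
  have hinner : ∀ j ∈ Finset.Ico 1 (p * M),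
      ∑ k ∈ Finset.Ico 1 (q * M), (if p * k = q * j then (p : ℝ) / j else 0) =
        if p ∣ j then (p : ℝ) / j else 0 := by
    intro j hj
    rw [Finset.mem_Ico] at hj
    by_cases hdvd : p ∣ j
    · rw [if_pos hdvd]
      obtain ⟨m, rfl⟩ := hdvd
      have hm1 : 1 ≤ m := by
        rcases Nat.eq_zero_or_pos m with h | h
        · subst h; simp at hj
        · exact h
      have hmM : m < M := Nat.lt_of_mul_lt_mul_left hj.2
      have hcond : ∀ k : ℕ, (p * k = q * (p * m) ↔ k = q * m) := by
        intro k
        constructor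
        · intro h
          apply Nat.eq_of_mul_eq_mul_left hp
          rw [h]; ring
        · rintro rfl; ring
      simp_rw [hcond]
      rw [Finset.sum_ite_eq' (Finset.Ico 1 (q * M)) (q * m) (fun _ => (p : ℝ) / ((p * m : ℕ) : ℝ))]
      rw [if_pos]
      rw [Finset.mem_Ico]
      exact ⟨Nat.one_le_iff_ne_zero.mpr (Nat.mul_ne_zero hq.ne' (by omega)), Nat.mul_lt_mul_of_pos_left hmM hq⟩
    · rw [if_neg hdvd]
      refine Finset.sum_eq_zero fun k _ => ?_
      rw [if_neg]
      intro h
      apply hdvd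
      have : p ∣ q * j := ⟨k, h.symm⟩
      exact hpq.dvd_of_dvd_mul_left this
  rw [Finset.sum_congr rfl hinner, sum_Ico_ite_dvd_eq hp]
  refine Finset.sum_congr rfl fun m hm => ?_
  rw [Finset.mem_Ico] at hm
  have hm' : (m : ℝ) ≠ 0 := by
    have : (1 : ℝ) ≤ m := by exact_mod_cast hm.1
    positivity
  push_cast
  field_simp

/-- **The double sum:** `S(M) = Σ_{j<pM} Σ_{k<qM} 1/max(j/p,k/q) = q(pM−1) + p(qM−1) − H_{M−1} − pΣ_j{qj/p}/j − qΣ_k{pk/q}/k`.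
[cite: BBLS2003AutocorrelationNotes, Prop. 89 — step 2: the finite master identity (inclusion–exclusion, residue re-indexing, antisymmetrisation)] -/
theorem sum_sum_one_div_max_eq {p q M : ℕ} (hp : 0 < p) (hq : 0 < q) (hpq : Nat.Coprime p q) (hM : 0 < M) :
    ∑ j ∈ Finset.Ico 1 (p * M), ∑ k ∈ Finset.Ico 1 (q * M), 1 / max ((j : ℝ) / p) ((k : ℝ) / q) =
      (q : ℝ) * ((p : ℝ) * M - 1) + (p : ℝ) * ((q : ℝ) * M - 1) - ∑ m ∈ Finset.Ico 1 M, 1 / (m : ℝ)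
        - p * ∑ j ∈ Finset.Ico 1 (p * M), Int.fract ((q : ℝ) * j / p) / j
        - q * ∑ k ∈ Finset.Ico 1 (q * M), Int.fract ((p : ℝ) * k / q) / k := by
  rw [Finset.sum_congr rfl fun j _ => Finset.sum_congr rfl fun k _ => one_div_max_eq_ite j k hp hq]
  simp only [Finset.sum_sub_distrib, Finset.sum_add_distrib]
  rw [sum_sum_ite_le_eq hp hq hM, sum_sum_ite_eq_eq hp hq hpq, Finset.sum_comm, sum_sum_ite_le_eq hq hp hM]
  ring

/-! ## Step 5: the finite master identity -/

/-- **Finite master identity.** For coprime `p, q ≥ 1` and `M ≥ 1`: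
`∫_0^M {px}{qx} x⁻² dx = 2pqM − p(qM log(qM) − log (qM)!) − q(pM log(pM) − log (pM)!) − H_{M−1} − 1/M
  − qΣ_{k<qM} {pk/q}/k − pΣ_{j<pM} {qj/p}/j`.
[cite: BBLS2003AutocorrelationNotes, Prop. 89 — step 2: the finite master identity (inclusion–exclusion, residue re-indexing, antisymmetrisation)] -/
theorem integral_fract_mul_fract_eq {p q M : ℕ} (hp : 0 < p) (hq : 0 < q) (hpq : Nat.Coprime p q) (hM : 0 < M) :
    ∫ x in (0 : ℝ)..M, Int.fract ((p : ℝ) * x) * Int.fract ((q : ℝ) * x) / x ^ 2 =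
      2 * (p : ℝ) * q * M
        - p * ((q : ℝ) * M * Real.log ((q : ℝ) * M) - Real.log ((q * M).factorial))
        - q * ((p : ℝ) * M * Real.log ((p : ℝ) * M) - Real.log ((p * M).factorial))
        - ∑ m ∈ Finset.Ico 1 M, 1 / (m : ℝ) - 1 / M
        - q * ∑ k ∈ Finset.Ico 1 (q * M), Int.fract ((p : ℝ) * k / q) / k
        - p * ∑ j ∈ Finset.Ico 1 (p * M), Int.fract ((q : ℝ) * j / p) / j := by
  have hM' : (M : ℝ) ≠ 0 := by exact_mod_cast hM.ne'
  rw [integral_fract_mul_fract_eq_sums hp hq hM, sum_Ico_mul_log_div hq hM, sum_Ico_mul_log_div hp hM]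
  simp only [Finset.sum_sub_distrib]
  rw [sum_sum_one_div_max_eq hp hq hpq hM]
  simp only [Finset.sum_const, Nat.card_Ico, nsmul_eq_mul]
  have h1 : 1 ≤ p * M := Nat.one_le_iff_ne_zero.mpr (Nat.mul_ne_zero hp.ne' hM.ne')
  have h2 : 1 ≤ q * M := Nat.one_le_iff_ne_zero.mpr (Nat.mul_ne_zero hq.ne' hM.ne')
  rw [Nat.cast_sub h1, Nat.cast_sub h2]
  push_cast
  field_simp
  ring

/-! ## Step 6: re-indexing the fractional sums by residues, antisymmetrisation -/

/-- Splitting off the `r = 0` term: `Σ_{r<q} f(r) = f(0) + Σ_{1≤r<q} f(r)` (`q ≥ 1`).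
[cite: BBLS2003AutocorrelationNotes, Prop. 89 — step 2: the finite master identity (inclusion–exclusion, residue re-indexing, antisymmetrisation)] -/
theorem sum_range_eq_add_sum_Ico (f : ℕ → ℝ) {q : ℕ} (hq : 0 < q) :
    ∑ r ∈ Finset.range q, f r = f 0 + ∑ r ∈ Finset.Ico 1 q, f r := by
  rw [Finset.range_eq_Ico, Finset.sum_eq_sum_Ico_succ_bot hq]

/-- `Σ_{k<qM} g(k mod q)·q/k = Σ_{r<q} g(r)·Σ_{n<M} q/(qn+r)` (the `k = 0` and `(n,r) = (0,0)` terms are `q/0 = 0`).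
[cite: BBLS2003AutocorrelationNotes, Prop. 89 — step 2: the finite master identity (inclusion–exclusion, residue re-indexing, antisymmetrisation)] -/
theorem sum_range_mul_mod_eq {q : ℕ} (g : ℕ → ℝ) (M : ℕ) :
    ∑ k ∈ Finset.range (q * M), g (k % q) * ((q : ℝ) / k) =
      ∑ r ∈ Finset.range q, g r * ∑ n ∈ Finset.range M, (q : ℝ) / ((q : ℝ) * n + r) := by
  induction M with
  | zero => simp
  | succ M ih =>
    rw [mul_add_one, Finset.sum_range_add, ih]
    simp only [Finset.sum_range_succ, mul_add, Finset.sum_add_distrib]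
    congr 1
    refine Finset.sum_congr rfl fun r hr => ?_
    rw [Finset.mem_range] at hr
    have hmod : (q * M + r) % q = r := by
      rw [add_comm, Nat.add_mul_mod_self_left, Nat.mod_eq_of_lt hr]
    rw [hmod]
    norm_cast

/-- The residue re-indexing of the fractional sums:
`q·Σ_{1≤k<qM} {pk/q}/k = Σ_{1≤r<q} {pr/q}·Σ_{n<M} q/(qn+r)`.
[cite: BBLS2003AutocorrelationNotes, Prop. 89 — step 2: the finite master identity (inclusion–exclusion, residue re-indexing, antisymmetrisation)] -/
theorem sum_fract_div_eq_sum_residue (p : ℕ) {q : ℕ} (hq : 0 < q) (M : ℕ) :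
    (q : ℝ) * ∑ k ∈ Finset.Ico 1 (q * M), Int.fract ((p : ℝ) * k / q) / k =
      ∑ r ∈ Finset.Ico 1 q, Int.fract ((p : ℝ) * r / q) * ∑ n ∈ Finset.range M, (q : ℝ) / ((q : ℝ) * n + r) := by
  have hq' : (q : ℝ) ≠ 0 := by exact_mod_cast hq.ne'
  have hL : (q : ℝ) * ∑ k ∈ Finset.Ico 1 (q * M), Int.fract ((p : ℝ) * k / q) / k =
      ∑ k ∈ Finset.range (q * M), Int.fract ((p : ℝ) * ↑(k % q) / q) * ((q : ℝ) / k) := by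
    rw [Finset.mul_sum]
    by_cases hM : M = 0
    · subst hM; simp
    have hqM : 0 < q * M := Nat.mul_pos hq (Nat.pos_of_ne_zero hM)
    rw [sum_range_eq_add_sum_Ico _ hqM]
    simp only [Nat.cast_zero, div_zero, mul_zero, zero_add]
    refine Finset.sum_congr rfl fun k _ => ?_
    have hmod : Int.fract ((p : ℝ) * ↑(k % q) / q) = Int.fract ((p : ℝ) * k / q) := by
      have hk : (k : ℝ) = (q : ℝ) * ↑(k / q) + ↑(k % q) := by exact_mod_cast (Nat.div_add_mod k q).symm
      have : (p : ℝ) * k / q = ((p * (k / q) : ℕ) : ℝ) + (p : ℝ) * ↑(k % q) / q := by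
        rw [hk, mul_add, add_div]
        push_cast
        congr 1
        field_simp
      rw [this, Int.fract_natCast_add]
    rw [hmod]
    ring
  have hR : ∑ r ∈ Finset.range q, Int.fract ((p : ℝ) * r / q) * ∑ n ∈ Finset.range M, (q : ℝ) / ((q : ℝ) * n + r) =
      ∑ r ∈ Finset.Ico 1 q, Int.fract ((p : ℝ) * r / q) * ∑ n ∈ Finset.range M, (q : ℝ) / ((q : ℝ) * n + r) := by
    rw [sum_range_eq_add_sum_Ico _ hq]
    simp
  rw [hL, ← hR]
  exact sum_range_mul_mod_eq (fun r => Int.fract ((p : ℝ) * r / q)) M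

/-- `Σ_{k<N+1} 1/k = H_N` (with `1/0 = 0`).
[cite: BBLS2003AutocorrelationNotes, Prop. 89 — step 2: the finite master identity (inclusion–exclusion, residue re-indexing, antisymmetrisation)] -/
theorem sum_range_one_div_eq_harmonic (N : ℕ) :
    ∑ k ∈ Finset.range (N + 1), 1 / (k : ℝ) = (harmonic N : ℝ) := by
  induction N with
  | zero => simp
  | succ N ih =>
    rw [Finset.sum_range_succ, ih, harmonic_succ]
    push_cast
    ring

/-- `Σ_{1≤m<M} 1/m = H_{M−1}`.
[cite: BBLS2003AutocorrelationNotes, Prop. 89 — step 2: the finite master identity (inclusion–exclusion, residue re-indexing, antisymmetrisation)] -/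
theorem sum_Ico_one_div_eq_harmonic {M : ℕ} (hM : 0 < M) :
    ∑ m ∈ Finset.Ico 1 M, 1 / (m : ℝ) = (harmonic (M - 1) : ℝ) := by
  obtain ⟨N, rfl⟩ : ∃ N, M = N + 1 := ⟨M - 1, by omega⟩
  rw [Nat.add_sub_cancel, ← sum_range_one_div_eq_harmonic, sum_range_eq_add_sum_Ico _ (Nat.succ_pos N)]
  simp

/-- `Σ_{k<nM} n/k = n·H_{nM−1}` for `n, M ≥ 1`.
[cite: BBLS2003AutocorrelationNotes, Prop. 89 — step 2: the finite master identity (inclusion–exclusion, residue re-indexing, antisymmetrisation)] -/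
theorem sum_range_div_eq_harmonic {n M : ℕ} (hn : 0 < n) (hM : 0 < M) :
    ∑ k ∈ Finset.range (n * M), (n : ℝ) / k = n * (harmonic (n * M - 1) : ℝ) := by
  obtain ⟨N, hN⟩ : ∃ N, n * M = N + 1 :=
    ⟨n * M - 1, by have : 1 ≤ n * M := Nat.one_le_iff_ne_zero.mpr (Nat.mul_ne_zero hn.ne' hM.ne'); omega⟩
  rw [hN, Nat.add_sub_cancel, ← sum_range_one_div_eq_harmonic, Finset.mul_sum]
  refine Finset.sum_congr rfl fun k _ => ?_
  ring

/-- The full residue sum: `Σ_{1≤r<q} Σ_{n<M} q/(qn+r) = q·H_{qM−1} − H_{M−1}` (`M ≥ 1`).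
[cite: BBLS2003AutocorrelationNotes, Prop. 89 — step 2: the finite master identity (inclusion–exclusion, residue re-indexing, antisymmetrisation)] -/
theorem sum_Ico_sum_range_div_eq {q M : ℕ} (hq : 0 < q) (hM : 0 < M) :
    ∑ r ∈ Finset.Ico 1 q, ∑ n ∈ Finset.range M, (q : ℝ) / ((q : ℝ) * n + r) =
      q * (harmonic (q * M - 1) : ℝ) - (harmonic (M - 1) : ℝ) := by
  have hall := sum_range_mul_mod_eq (q := q) (fun _ => (1 : ℝ)) M
  simp only [one_mul] at hall
  rw [sum_range_div_eq_harmonic hq hM, sum_range_eq_add_sum_Ico _ hq] at hall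
  have h0 : ∑ n ∈ Finset.range M, (q : ℝ) / ((q : ℝ) * n + ((0 : ℕ) : ℝ)) = (harmonic (M - 1) : ℝ) := by
    obtain ⟨N, rfl⟩ : ∃ N, M = N + 1 := ⟨M - 1, by omega⟩
    rw [Nat.add_sub_cancel, ← sum_range_one_div_eq_harmonic]
    refine Finset.sum_congr rfl fun n _ => ?_
    have hq' : (q : ℝ) ≠ 0 := by exact_mod_cast hq.ne'
    rw [Nat.cast_zero, add_zero, div_mul_eq_div_div, div_self hq']
  rw [h0] at hall
  linarith

/-- The reflected residue: for `1 ≤ r < q` coprime data, `{p(q−r)/q} = 1 − {pr/q}`.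
[cite: BBLS2003AutocorrelationNotes, Prop. 89 — step 2: the finite master identity (inclusion–exclusion, residue re-indexing, antisymmetrisation)] -/
theorem fract_mul_sub_div_eq {p q r : ℕ} (hpq : Nat.Coprime p q) (hr : r ∈ Finset.Ico 1 q) :
    Int.fract ((p : ℝ) * ↑(q - r) / q) = 1 - Int.fract ((p : ℝ) * r / q) := by
  rw [Finset.mem_Ico] at hr
  have hq : 0 < q := by omega
  have hq' : (q : ℝ) ≠ 0 := by exact_mod_cast hq.ne'
  have hne : Int.fract ((p : ℝ) * r / q) ≠ 0 := by
    rw [show (p : ℝ) * r / q = ((p * r : ℕ) : ℝ) / q by push_cast; ring,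
      Int.fract_div_natCast_eq_div_natCast_mod]
    have hmod : (p * r) % q ≠ 0 := by
      intro h0
      have hdvd : q ∣ p * r := Nat.dvd_of_mod_eq_zero h0
      have hqr : q ∣ r := hpq.symm.dvd_of_dvd_mul_left hdvd
      exact absurd (Nat.le_of_dvd (by omega) hqr) (by omega)
    have : ((p * r % q : ℕ) : ℝ) ≠ 0 := by exact_mod_cast hmod
    exact div_ne_zero this hq'
  rw [Nat.cast_sub hr.2.le,
    show (p : ℝ) * ((q : ℝ) - r) / q = -((p : ℝ) * r / q) + (p : ℕ) by field_simp; ring,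
    Int.fract_add_natCast, Int.fract_neg hne]

/-- **Antisymmetrisation:** `2·Σ_{1≤r<q} {pr/q} h(r) = Σ_{1≤r<q} h(r) + Σ_{1≤r<q} {pr/q}(h(r) − h(q−r))`.
[cite: BBLS2003AutocorrelationNotes, Prop. 89 — step 2: the finite master identity (inclusion–exclusion, residue re-indexing, antisymmetrisation)] -/
theorem two_mul_sum_fract_mul_eq {p q : ℕ} (hpq : Nat.Coprime p q) (h : ℕ → ℝ) :
    2 * ∑ r ∈ Finset.Ico 1 q, Int.fract ((p : ℝ) * r / q) * h r =
      ∑ r ∈ Finset.Ico 1 q, h r + ∑ r ∈ Finset.Ico 1 q, Int.fract ((p : ℝ) * r / q) * (h r - h (q - r)) := by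
  have hrefl : ∀ f : ℕ → ℝ, ∑ r ∈ Finset.Ico 1 q, f (q - r) = ∑ r ∈ Finset.Ico 1 q, f r := by
    intro f
    have := Finset.sum_Ico_reflect f 1 (m := q) (n := q) (by omega)
    rw [show q + 1 - q = 1 by omega, show q + 1 - 1 = q by omega] at this
    exact this
  have key : ∑ r ∈ Finset.Ico 1 q, Int.fract ((p : ℝ) * r / q) * h r =
      ∑ r ∈ Finset.Ico 1 q, h r - ∑ r ∈ Finset.Ico 1 q, Int.fract ((p : ℝ) * r / q) * h (q - r) := by
    rw [← hrefl (fun r => Int.fract ((p : ℝ) * r / q) * h r), ← hrefl h, ← Finset.sum_sub_distrib]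
    refine Finset.sum_congr rfl fun r hr => ?_
    show Int.fract ((p : ℝ) * ↑(q - r) / q) * h (q - r) = h (q - r) - Int.fract ((p : ℝ) * r / q) * h (q - r)
    rw [fract_mul_sub_div_eq hpq hr]
    ring
  have hsplit : ∑ r ∈ Finset.Ico 1 q, Int.fract ((p : ℝ) * r / q) * (h r - h (q - r)) =
      ∑ r ∈ Finset.Ico 1 q, Int.fract ((p : ℝ) * r / q) * h r
        - ∑ r ∈ Finset.Ico 1 q, Int.fract ((p : ℝ) * r / q) * h (q - r) := by
    rw [← Finset.sum_sub_distrib]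
    refine Finset.sum_congr rfl fun r _ => ?_
    ring
  rw [hsplit]
  linarith

/-- The antisymmetrised residue sum is the partial sum of the cotangent series:
`Σ_{n<M} (q/(qn+r) − q/(qn+(q−r))) = Σ_{n<M} (1/(n + r/q) − 1/(n + 1 − r/q))`.
[cite: BBLS2003AutocorrelationNotes, Prop. 89 — step 2: the finite master identity (inclusion–exclusion, residue re-indexing, antisymmetrisation)] -/
theorem sum_range_div_sub_div_eq {q r : ℕ} (hq : 0 < q) (hr : r ∈ Finset.Ico 1 q) (M : ℕ) :
    ∑ n ∈ Finset.range M, (q : ℝ) / ((q : ℝ) * n + r)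
        - ∑ n ∈ Finset.range M, (q : ℝ) / ((q : ℝ) * n + ↑(q - r)) =
      ∑ n ∈ Finset.range M, (1 / ((n : ℝ) + (r : ℝ) / q) - 1 / ((n : ℝ) + 1 - (r : ℝ) / q)) := by
  rw [Finset.mem_Ico] at hr
  have hq0 : (q : ℝ) ≠ 0 := by exact_mod_cast hq.ne'
  rw [← Finset.sum_sub_distrib]
  refine Finset.sum_congr rfl fun n _ => ?_
  have e1 : ((q : ℝ) * n + r) / q = (n : ℝ) + (r : ℝ) / q := by
    rw [add_div, mul_div_cancel_left₀ _ hq0]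
  have e2 : ((q : ℝ) * n + ((q : ℝ) - r)) / q = (n : ℝ) + 1 - (r : ℝ) / q := by
    rw [add_div, mul_div_cancel_left₀ _ hq0, sub_div, div_self hq0]
    ring
  rw [Nat.cast_sub hr.2.le, ← e1, ← e2, one_div_div, one_div_div]

end Vasyunin
end Literature.NumberTheory.LFunctions.NymanBeurling

end Part2

/-!
## Part 3 — port of `Summits/RiemannHypothesis/RiemannHypothesis/Theorems/NymanBeurlingVasyunin.lean` (11 declarations kept)

# Vasyunin's formula, III: the limit `M → ∞` and BBLS 2003 Prop. 89

From the finite master identity (`Vasyunin.integral_fract_mul_fract_eq`) we pass to the limit `M → ∞` with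

* the cotangent partial fractions on `(0,1)`: `Σ_{n<M} (1/(n+x) − 1/(n+1−x)) → π cot(πx)`
  (`tendsto_sum_one_div_sub_one_div`, from `Literature.Analysis.SpecialFunctions.hasSum_pi_mul_cot_sub_inv`, i.e.
  Mathlib's `cot_series_rep'`);
* Stirling in the form `N log N − log N! = N − ½ log(2N) − log s_N`, `s_N → √π` (`Stirling.stirlingSeq`);
* `H_{nM−1} − log(nM) → γ` (`Real.tendsto_harmonic_sub_log_add_one`);

obtaining **`∫_0^∞ {px}{qx} x⁻² dx = ((q−p)/2)(log p − log q) + ((p+q)/2)(log 2π − γ) − (π/2)(V(p,q) + V(q,p))`**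
(`integral_Ioi_fract_mul_fract_div_sq`; integrability `integrableOn_fract_mul_fract_div_sq`), and with
`A(p/q) = q⁻¹ ∫_0^∞ {px}{qx} x⁻² dx` (`fractAutocorr_div_eq`, substitution `t = qx`):
**`bbls2003_prop89_holds : BBLS2003_prop89`** — for coprime positive `p, q`, `λ = p/q`,
`A(λ) = (1−λ)/2 · log λ + (λ+1)/2 · (log 2π − γ) − (π/(2q)) (V(p,q) + V(q,p))` (Vasyunin 1996; BBLS 2003 Prop. 89).
The Gram-matrix corollary of the source module (`nbGram_eq_vasyunin`, route object) is not re-homed.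
-/

section Part3

open _root_.MeasureTheory _root_.Set

namespace Literature.NumberTheory.LFunctions.NymanBeurling

open Literature.NumberTheory.LFunctions

namespace Vasyunin

/-! ## Step 7: the limits -/

/-- The cotangent partial fractions on `(0,1)`: `Σ_{n<M} (1/(n+x) − 1/(n+1−x)) → π cot(πx)`.
[cite: BBLS2003AutocorrelationNotes, Prop. 89 (Vasyunin 1996): A(p/q) = (1−λ)/2·log λ + (λ+1)/2·(log 2π − γ) − (π/(2q))(V(p,q)+V(q,p)) — step 3: the limit M → ∞ (Stirling, H_n − log n → γ, cotangent partial fractions)] -/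
theorem tendsto_sum_one_div_sub_one_div {x : ℝ} (hx0 : 0 < x) (hx1 : x < 1) :
    Filter.Tendsto (fun M : ℕ => ∑ n ∈ Finset.range M, (1 / ((n : ℝ) + x) - 1 / ((n : ℝ) + 1 - x)))
      Filter.atTop (nhds (Real.pi * Real.cot (Real.pi * x))) := by
  have hxZ : ∀ n : ℤ, x ≠ n := by
    intro n hn
    have h0 : (0 : ℝ) < n := hn ▸ hx0
    have h1 : (n : ℝ) < 1 := hn ▸ hx1
    have h0' : (0 : ℤ) < n := by exact_mod_cast h0
    have h1' : n < (1 : ℤ) := by exact_mod_cast h1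
    omega
  have hS := (Literature.Analysis.SpecialFunctions.hasSum_pi_mul_cot_sub_inv hxZ).tendsto_sum_nat
  have hid : ∀ M : ℕ, ∑ n ∈ Finset.range M, (1 / ((n : ℝ) + x) - 1 / ((n : ℝ) + 1 - x)) =
      1 / x - 1 / (x + M) + ∑ n ∈ Finset.range M, (1 / (x - (n + 1)) + 1 / (x + (n + 1))) := by
    intro M
    induction M with
    | zero => simp
    | succ M ih =>
      rw [Finset.sum_range_succ, Finset.sum_range_succ, ih]
      push_cast
      have hM : (0 : ℝ) ≤ M := Nat.cast_nonneg M
      have h1 : (M : ℝ) + 1 - x ≠ 0 := by linarith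
      have h2 : x - ((M : ℝ) + 1) ≠ 0 := by linarith
      have h3 : x + M ≠ 0 := by positivity
      have h4 : x + ((M : ℝ) + 1) ≠ 0 := by positivity
      have h5 : (M : ℝ) + x ≠ 0 := by positivity
      have hx : x ≠ 0 := hx0.ne'
      field_simp
      ring
  simp_rw [hid]
  have hlim1 : Filter.Tendsto (fun M : ℕ => 1 / x - 1 / (x + M)) Filter.atTop (nhds (1 / x - 0)) := by
    refine tendsto_const_nhds.sub ?_
    have : Filter.Tendsto (fun M : ℕ => x + (M : ℝ)) Filter.atTop Filter.atTop :=
      Filter.tendsto_atTop_add_const_left _ _ tendsto_natCast_atTop_atTop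
    exact tendsto_const_nhds.div_atTop this
  have := hlim1.add hS
  convert this using 2
  ring

/-- Stirling: `N log N − log N! = N − ½ log(2N) − log s_N` (`s_N` = `Stirling.stirlingSeq N`, `N ≥ 1`).
[cite: BBLS2003AutocorrelationNotes, Prop. 89 (Vasyunin 1996): A(p/q) = (1−λ)/2·log λ + (λ+1)/2·(log 2π − γ) − (π/(2q))(V(p,q)+V(q,p)) — step 3: the limit M → ∞ (Stirling, H_n − log n → γ, cotangent partial fractions)] -/
theorem mul_log_sub_log_factorial_eq {N : ℕ} (hN : 0 < N) :
    (N : ℝ) * Real.log N - Real.log (N.factorial) =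
      N - 1 / 2 * Real.log (2 * N) - Real.log (Stirling.stirlingSeq N) := by
  have hN' : (0 : ℝ) < N := by exact_mod_cast hN
  rw [Stirling.log_stirlingSeq_formula, Real.log_div hN'.ne' (Real.exp_pos 1).ne', Real.log_exp]
  ring

/-- The same along `N = nM`, with the casts split: `nM log(nM) − log (nM)! = nM − ½ log(2nM) − log s_{nM}`.
[cite: BBLS2003AutocorrelationNotes, Prop. 89 (Vasyunin 1996): A(p/q) = (1−λ)/2·log λ + (λ+1)/2·(log 2π − γ) − (π/(2q))(V(p,q)+V(q,p)) — step 3: the limit M → ∞ (Stirling, H_n − log n → γ, cotangent partial fractions)] -/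
theorem mul_log_sub_log_factorial_eq' {n M : ℕ} (hn : 0 < n) (hM : 0 < M) :
    (n : ℝ) * M * Real.log ((n : ℝ) * M) - Real.log ((n * M).factorial) =
      (n : ℝ) * M - 1 / 2 * Real.log (2 * ((n : ℝ) * M)) - Real.log (Stirling.stirlingSeq (n * M)) := by
  have h := mul_log_sub_log_factorial_eq (Nat.mul_pos hn hM)
  push_cast at h
  exact h

/-- `H_{nM−1} − log(nM) → γ` along `M → ∞` (`n ≥ 1`).
[cite: BBLS2003AutocorrelationNotes, Prop. 89 (Vasyunin 1996): A(p/q) = (1−λ)/2·log λ + (λ+1)/2·(log 2π − γ) − (π/(2q))(V(p,q)+V(q,p)) — step 3: the limit M → ∞ (Stirling, H_n − log n → γ, cotangent partial fractions)] -/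
theorem tendsto_harmonic_mul_sub_log {n : ℕ} (hn : 0 < n) :
    Filter.Tendsto (fun M : ℕ => (harmonic (n * M - 1) : ℝ) - Real.log ((n : ℝ) * M)) Filter.atTop
      (nhds Real.eulerMascheroniConstant) := by
  have hsub : Filter.Tendsto (fun M : ℕ => n * M - 1) Filter.atTop Filter.atTop :=
    Filter.tendsto_atTop_mono (fun M => Nat.sub_le_sub_right (Nat.le_mul_of_pos_left M hn) 1)
      (Filter.tendsto_sub_atTop_nat 1)
  refine (Real.tendsto_harmonic_sub_log_add_one.comp hsub).congr' ?_
  filter_upwards [Filter.eventually_ge_atTop 1] with M hM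
  have h1 : 1 ≤ n * M := Nat.one_le_iff_ne_zero.mpr (Nat.mul_ne_zero hn.ne' (by omega))
  simp only [Function.comp_apply]
  rw [Nat.cast_sub h1]
  push_cast
  ring_nf

/-- `log s_{nM} → ½ log π` along `M → ∞` (`n ≥ 1`).
[cite: BBLS2003AutocorrelationNotes, Prop. 89 (Vasyunin 1996): A(p/q) = (1−λ)/2·log λ + (λ+1)/2·(log 2π − γ) − (π/(2q))(V(p,q)+V(q,p)) — step 3: the limit M → ∞ (Stirling, H_n − log n → γ, cotangent partial fractions)] -/
theorem tendsto_log_stirlingSeq_mul {n : ℕ} (hn : 0 < n) :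
    Filter.Tendsto (fun M : ℕ => Real.log (Stirling.stirlingSeq (n * M))) Filter.atTop
      (nhds (Real.log Real.pi / 2)) := by
  have hmul : Filter.Tendsto (fun M : ℕ => n * M) Filter.atTop Filter.atTop :=
    Filter.tendsto_atTop_mono (fun M => Nat.le_mul_of_pos_left M hn) Filter.tendsto_id
  rw [← Real.log_sqrt Real.pi_pos.le]
  exact ((Real.continuousAt_log (Real.sqrt_pos.2 Real.pi_pos).ne').tendsto.comp
    Stirling.tendsto_stirlingSeq_sqrt_pi).comp hmul

/-- The fractional sum in limit-ready form (`M ≥ 1`):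
`q Σ_{k<qM} {pk/q}/k = ½(qH_{qM−1} − H_{M−1}) + ½ Σ_{r<q} {pr/q}·D_M(r/q)`.
[cite: BBLS2003AutocorrelationNotes, Prop. 89 (Vasyunin 1996): A(p/q) = (1−λ)/2·log λ + (λ+1)/2·(log 2π − γ) − (π/(2q))(V(p,q)+V(q,p)) — step 3: the limit M → ∞ (Stirling, H_n − log n → γ, cotangent partial fractions)] -/
theorem fract_sum_eq_half {p q M : ℕ} (hq : 0 < q) (hpq : Nat.Coprime p q) (hM : 0 < M) :
    (q : ℝ) * ∑ k ∈ Finset.Ico 1 (q * M), Int.fract ((p : ℝ) * k / q) / k =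
      1 / 2 * (q * (harmonic (q * M - 1) : ℝ) - (harmonic (M - 1) : ℝ))
        + 1 / 2 * ∑ r ∈ Finset.Ico 1 q, Int.fract ((p : ℝ) * r / q) *
            ∑ n ∈ Finset.range M, (1 / ((n : ℝ) + (r : ℝ) / q) - 1 / ((n : ℝ) + 1 - (r : ℝ) / q)) := by
  rw [sum_fract_div_eq_sum_residue p hq M]
  have h2 := two_mul_sum_fract_mul_eq hpq (fun r => ∑ n ∈ Finset.range M, (q : ℝ) / ((q : ℝ) * n + r))
  rw [sum_Ico_sum_range_div_eq hq hM] at h2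
  have h3 : ∑ r ∈ Finset.Ico 1 q, Int.fract ((p : ℝ) * r / q) *
      (∑ n ∈ Finset.range M, (q : ℝ) / ((q : ℝ) * n + r) - ∑ n ∈ Finset.range M, (q : ℝ) / ((q : ℝ) * n + ↑(q - r))) =
      ∑ r ∈ Finset.Ico 1 q, Int.fract ((p : ℝ) * r / q) *
        ∑ n ∈ Finset.range M, (1 / ((n : ℝ) + (r : ℝ) / q) - 1 / ((n : ℝ) + 1 - (r : ℝ) / q)) := by
    refine Finset.sum_congr rfl fun r hr => ?_
    rw [sum_range_div_sub_div_eq hq hr]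
  rw [h3] at h2
  linarith

/-- **The limit of the finite master identity's right-hand side.**
[cite: BBLS2003AutocorrelationNotes, Prop. 89 (Vasyunin 1996): A(p/q) = (1−λ)/2·log λ + (λ+1)/2·(log 2π − γ) − (π/(2q))(V(p,q)+V(q,p)) — step 3: the limit M → ∞ (Stirling, H_n − log n → γ, cotangent partial fractions)] -/
theorem tendsto_master_rhs {p q : ℕ} (hp : 0 < p) (hq : 0 < q) (hpq : Nat.Coprime p q) :
    Filter.Tendsto (fun M : ℕ =>
      2 * (p : ℝ) * q * M
        - p * ((q : ℝ) * M * Real.log ((q : ℝ) * M) - Real.log ((q * M).factorial))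
        - q * ((p : ℝ) * M * Real.log ((p : ℝ) * M) - Real.log ((p * M).factorial))
        - ∑ m ∈ Finset.Ico 1 M, 1 / (m : ℝ) - 1 / M
        - q * ∑ k ∈ Finset.Ico 1 (q * M), Int.fract ((p : ℝ) * k / q) / k
        - p * ∑ j ∈ Finset.Ico 1 (p * M), Int.fract ((q : ℝ) * j / p) / j) Filter.atTop
      (nhds ((((q : ℝ) - p) / 2) * (Real.log p - Real.log q)
        + (((p : ℝ) + q) / 2) * (Real.log 2 + Real.log Real.pi - Real.eulerMascheroniConstant)
        - Real.pi / 2 * (∑ r ∈ Finset.Ico 1 q, Int.fract ((p : ℝ) * r / q) * Real.cot (Real.pi * ((r : ℝ) / q))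
            + ∑ j ∈ Finset.Ico 1 p, Int.fract ((q : ℝ) * j / p) * Real.cot (Real.pi * ((j : ℝ) / p))))) := by
  have hp' : (0 : ℝ) < p := by exact_mod_cast hp
  have hq' : (0 : ℝ) < q := by exact_mod_cast hq
  -- the limit-able pieces
  set Dq : ℕ → ℝ := fun M => ∑ r ∈ Finset.Ico 1 q, Int.fract ((p : ℝ) * r / q) *
      ∑ n ∈ Finset.range M, (1 / ((n : ℝ) + (r : ℝ) / q) - 1 / ((n : ℝ) + 1 - (r : ℝ) / q)) with hDq
  set Dp : ℕ → ℝ := fun M => ∑ j ∈ Finset.Ico 1 p, Int.fract ((q : ℝ) * j / p) *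
      ∑ n ∈ Finset.range M, (1 / ((n : ℝ) + (j : ℝ) / p) - 1 / ((n : ℝ) + 1 - (j : ℝ) / p)) with hDp
  set C0 : ℝ := (((p : ℝ) + q) / 2) * Real.log 2 + (((q : ℝ) - p) / 2) * (Real.log p - Real.log q) with hC0
  have hnice : ∀ᶠ M : ℕ in Filter.atTop,
      C0 - q / 2 * ((harmonic (q * M - 1) : ℝ) - Real.log ((q : ℝ) * M))
        - p / 2 * ((harmonic (p * M - 1) : ℝ) - Real.log ((p : ℝ) * M))
        + p * Real.log (Stirling.stirlingSeq (q * M)) + q * Real.log (Stirling.stirlingSeq (p * M))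
        - 1 / M - 1 / 2 * Dq M - 1 / 2 * Dp M =
      2 * (p : ℝ) * q * M
        - p * ((q : ℝ) * M * Real.log ((q : ℝ) * M) - Real.log ((q * M).factorial))
        - q * ((p : ℝ) * M * Real.log ((p : ℝ) * M) - Real.log ((p * M).factorial))
        - ∑ m ∈ Finset.Ico 1 M, 1 / (m : ℝ) - 1 / M
        - q * ∑ k ∈ Finset.Ico 1 (q * M), Int.fract ((p : ℝ) * k / q) / k
        - p * ∑ j ∈ Finset.Ico 1 (p * M), Int.fract ((q : ℝ) * j / p) / j := by
    filter_upwards [Filter.eventually_ge_atTop 1] with M hM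
    have hM0 : 0 < M := by omega
    have hM' : (0 : ℝ) < M := by exact_mod_cast hM0
    rw [fract_sum_eq_half hq hpq hM0, fract_sum_eq_half hp hpq.symm hM0, sum_Ico_one_div_eq_harmonic hM0,
      mul_log_sub_log_factorial_eq' hq hM0, mul_log_sub_log_factorial_eq' hp hM0]
    have hl1 : Real.log (2 * ((q : ℝ) * M)) = Real.log 2 + Real.log q + Real.log M := by
      rw [Real.log_mul (by norm_num) (by positivity), Real.log_mul hq'.ne' hM'.ne']
      ring
    have hl2 : Real.log (2 * ((p : ℝ) * M)) = Real.log 2 + Real.log p + Real.log M := by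
      rw [Real.log_mul (by norm_num) (by positivity), Real.log_mul hp'.ne' hM'.ne']
      ring
    have hl3 : Real.log ((q : ℝ) * M) = Real.log q + Real.log M := Real.log_mul hq'.ne' hM'.ne'
    have hl4 : Real.log ((p : ℝ) * M) = Real.log p + Real.log M := Real.log_mul hp'.ne' hM'.ne'
    rw [hl1, hl2, hl3, hl4]
    simp only [hC0, hDq, hDp]
    ring
  -- limits of the pieces
  have tq := tendsto_harmonic_mul_sub_log hq (n := q)
  have tp := tendsto_harmonic_mul_sub_log hp (n := p)
  have sq := tendsto_log_stirlingSeq_mul hq (n := q)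
  have sp := tendsto_log_stirlingSeq_mul hp (n := p)
  have tM : Filter.Tendsto (fun M : ℕ => 1 / (M : ℝ)) Filter.atTop (nhds 0) := tendsto_const_div_atTop_nhds_zero_nat 1
  have tDq : Filter.Tendsto Dq Filter.atTop
      (nhds (Real.pi * ∑ r ∈ Finset.Ico 1 q, Int.fract ((p : ℝ) * r / q) * Real.cot (Real.pi * ((r : ℝ) / q)))) := by
    rw [Finset.mul_sum]
    refine tendsto_finsetSum _ fun r hr => ?_
    rw [Finset.mem_Ico] at hr
    have h0 : (0 : ℝ) < (r : ℝ) / q := by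
      have : (0 : ℝ) < r := by exact_mod_cast hr.1
      positivity
    have h1 : (r : ℝ) / q < 1 := by
      rw [div_lt_one hq']; exact_mod_cast hr.2
    have h := (tendsto_sum_one_div_sub_one_div h0 h1).const_mul (Int.fract ((p : ℝ) * r / q))
    rw [show Real.pi * (Int.fract ((p : ℝ) * r / q) * Real.cot (Real.pi * ((r : ℝ) / q)))
      = Int.fract ((p : ℝ) * r / q) * (Real.pi * Real.cot (Real.pi * ((r : ℝ) / q))) by ring]
    exact h
  have tDp : Filter.Tendsto Dp Filter.atTop
      (nhds (Real.pi * ∑ j ∈ Finset.Ico 1 p, Int.fract ((q : ℝ) * j / p) * Real.cot (Real.pi * ((j : ℝ) / p)))) := by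
    rw [Finset.mul_sum]
    refine tendsto_finsetSum _ fun j hj => ?_
    rw [Finset.mem_Ico] at hj
    have h0 : (0 : ℝ) < (j : ℝ) / p := by
      have : (0 : ℝ) < j := by exact_mod_cast hj.1
      positivity
    have h1 : (j : ℝ) / p < 1 := by
      rw [div_lt_one hp']; exact_mod_cast hj.2
    have h := (tendsto_sum_one_div_sub_one_div h0 h1).const_mul (Int.fract ((q : ℝ) * j / p))
    rw [show Real.pi * (Int.fract ((q : ℝ) * j / p) * Real.cot (Real.pi * ((j : ℝ) / p)))
      = Int.fract ((q : ℝ) * j / p) * (Real.pi * Real.cot (Real.pi * ((j : ℝ) / p))) by ring]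
    exact h
  have hlim := (((((((tendsto_const_nhds (x := C0)).sub (tq.const_mul ((q : ℝ) / 2))).sub
    (tp.const_mul ((p : ℝ) / 2))).add (sq.const_mul (p : ℝ))).add (sp.const_mul (q : ℝ))).sub tM).sub
      (tDq.const_mul (1 / 2))).sub (tDp.const_mul (1 / 2))
  refine Filter.Tendsto.congr' hnice ?_
  convert hlim using 2
  rw [hC0]
  ring

/-! ## Step 8: from `A(p/q)` to the improper integral, and the conclusion -/

/-- `x ↦ {px}{qx}/x²` is integrable on `(0, ∞)` (bounded by `pq` near `0`, by `x⁻²` at infinity).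
[cite: BBLS2003AutocorrelationNotes, Prop. 89 (Vasyunin 1996): A(p/q) = (1−λ)/2·log λ + (λ+1)/2·(log 2π − γ) − (π/(2q))(V(p,q)+V(q,p)) — step 3: the limit M → ∞ (Stirling, H_n − log n → γ, cotangent partial fractions)] -/
theorem integrableOn_fract_mul_fract_div_sq (p q : ℕ) :
    IntegrableOn (fun x : ℝ => Int.fract ((p : ℝ) * x) * Int.fract ((q : ℝ) * x) / x ^ 2) (Ioi 0) := by
  set F : ℝ → ℝ := fun x => Int.fract ((p : ℝ) * x) * Int.fract ((q : ℝ) * x) / x ^ 2 with hF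
  have hmeas : Measurable F := by
    have m1 : Measurable (fun x : ℝ => Int.fract ((p : ℝ) * x)) :=
      measurable_fract.comp (measurable_const.mul measurable_id)
    have m2 : Measurable (fun x : ℝ => Int.fract ((q : ℝ) * x)) :=
      measurable_fract.comp (measurable_const.mul measurable_id)
    exact (m1.mul m2).div (measurable_id.pow_const 2)
  have hnn : ∀ x : ℝ, 0 ≤ F x := fun x =>
    div_nonneg (mul_nonneg (Int.fract_nonneg _) (Int.fract_nonneg _)) (sq_nonneg x)
  have hfract_le : ∀ (n : ℕ) (x : ℝ), 0 ≤ x → Int.fract ((n : ℝ) * x) ≤ (n : ℝ) * x := by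
    intro n x hx
    have h0 : 0 ≤ (n : ℝ) * x := by positivity
    rw [← Int.self_sub_floor]
    have : (0 : ℝ) ≤ ⌊(n : ℝ) * x⌋ := by exact_mod_cast Int.floor_nonneg.mpr h0
    linarith
  -- near zero
  have h01 : IntegrableOn F (Ioc 0 1) := by
    have hc : IntegrableOn (fun _ : ℝ => (p : ℝ) * q) (Ioc 0 1) := integrableOn_const (by simp)
    refine hc.mono' hmeas.aestronglyMeasurable ?_
    refine (ae_restrict_iff' measurableSet_Ioc).mpr (ae_of_all _ fun x hx => ?_)
    rw [Real.norm_of_nonneg (hnn x), hF]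
    simp only
    have hx0 : 0 < x := hx.1
    rw [div_le_iff₀ (by positivity)]
    calc Int.fract ((p : ℝ) * x) * Int.fract ((q : ℝ) * x) ≤ ((p : ℝ) * x) * ((q : ℝ) * x) :=
          mul_le_mul (hfract_le p x hx0.le) (hfract_le q x hx0.le) (Int.fract_nonneg _) (by positivity)
      _ = (p : ℝ) * q * x ^ 2 := by ring
  -- at infinity
  have h1i : IntegrableOn F (Ioi 1) := by
    have hr : IntegrableOn (fun x : ℝ => x ^ (-2 : ℝ)) (Ioi 1) :=
      integrableOn_Ioi_rpow_of_lt (by norm_num) zero_lt_one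
    refine hr.mono' hmeas.aestronglyMeasurable ?_
    refine (ae_restrict_iff' measurableSet_Ioi).mpr (ae_of_all _ fun x hx => ?_)
    rw [Real.norm_of_nonneg (hnn x), hF]
    simp only
    have hx0 : 0 < x := lt_trans zero_lt_one hx
    rw [Real.rpow_neg hx0.le, Real.rpow_two, div_eq_mul_inv]
    refine mul_le_of_le_one_left (inv_nonneg.mpr (sq_nonneg x)) ?_
    calc Int.fract ((p : ℝ) * x) * Int.fract ((q : ℝ) * x) ≤ 1 * 1 :=
          mul_le_mul (Int.fract_lt_one _).le (Int.fract_lt_one _).le (Int.fract_nonneg _) zero_le_one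
      _ = 1 := one_mul 1
  have h := h01.union h1i
  rwa [Ioc_union_Ioi_eq_Ioi zero_le_one] at h

/-- `A(p/q) = (1/q)·∫_0^∞ {px}{qx} x⁻² dx` (substitution `t = qx`).
[cite: BBLS2003AutocorrelationNotes, Prop. 89 (Vasyunin 1996): A(p/q) = (1−λ)/2·log λ + (λ+1)/2·(log 2π − γ) − (π/(2q))(V(p,q)+V(q,p)) — step 3: the limit M → ∞ (Stirling, H_n − log n → γ, cotangent partial fractions)] -/
theorem fractAutocorr_div_eq (p : ℕ) {q : ℕ} (hq : 0 < q) :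
    fractAutocorr ((p : ℝ) / q) =
      1 / q * ∫ x in Ioi (0 : ℝ), Int.fract ((p : ℝ) * x) * Int.fract ((q : ℝ) * x) / x ^ 2 := by
  have hq' : (0 : ℝ) < q := by exact_mod_cast hq
  unfold fractAutocorr
  set g : ℝ → ℝ := fun t => Int.fract t * Int.fract ((p : ℝ) / q * t) / t ^ 2 with hg
  have h := integral_comp_mul_left_Ioi g 0 hq'
  rw [mul_zero, smul_eq_mul] at h
  have hcongr : ∫ x in Ioi (0 : ℝ), g ((q : ℝ) * x) =
      ∫ x in Ioi (0 : ℝ), 1 / (q : ℝ) ^ 2 * (Int.fract ((p : ℝ) * x) * Int.fract ((q : ℝ) * x) / x ^ 2) := by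
    refine setIntegral_congr_fun measurableSet_Ioi fun x hx => ?_
    have hx0 : x ≠ 0 := ne_of_gt hx
    have hq0 : (q : ℝ) ≠ 0 := hq'.ne'
    simp only [hg]
    rw [show (p : ℝ) / q * ((q : ℝ) * x) = (p : ℝ) * x by field_simp]
    field_simp
  rw [hcongr, integral_const_mul] at h
  have hsolve : ∫ x in Ioi (0 : ℝ), g x = q * ((q : ℝ)⁻¹ * ∫ x in Ioi (0 : ℝ), g x) := by
    rw [← mul_assoc, mul_inv_cancel₀ hq'.ne', one_mul]
  rw [hsolve, ← h, ← mul_assoc]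
  congr 1
  have hq0 : (q : ℝ) ≠ 0 := hq'.ne'
  field_simp

/-- **`∫_0^∞ {px}{qx} x⁻² dx` in closed form** (coprime `p, q ≥ 1`):
`= ((q−p)/2)(log p − log q) + ((p+q)/2)(log 2 + log π − γ) − (π/2)(Σ_r {pr/q} cot(πr/q) + Σ_j {qj/p} cot(πj/p))`.
[cite: BBLS2003AutocorrelationNotes, Prop. 89 (Vasyunin 1996): A(p/q) = (1−λ)/2·log λ + (λ+1)/2·(log 2π − γ) − (π/(2q))(V(p,q)+V(q,p)) — step 3: the limit M → ∞ (Stirling, H_n − log n → γ, cotangent partial fractions)] -/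
theorem integral_Ioi_fract_mul_fract_div_sq {p q : ℕ} (hp : 0 < p) (hq : 0 < q) (hpq : Nat.Coprime p q) :
    ∫ x in Ioi (0 : ℝ), Int.fract ((p : ℝ) * x) * Int.fract ((q : ℝ) * x) / x ^ 2 =
      (((q : ℝ) - p) / 2) * (Real.log p - Real.log q)
        + (((p : ℝ) + q) / 2) * (Real.log 2 + Real.log Real.pi - Real.eulerMascheroniConstant)
        - Real.pi / 2 * (∑ r ∈ Finset.Ico 1 q, Int.fract ((p : ℝ) * r / q) * Real.cot (Real.pi * ((r : ℝ) / q))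
            + ∑ j ∈ Finset.Ico 1 p, Int.fract ((q : ℝ) * j / p) * Real.cot (Real.pi * ((j : ℝ) / p))) := by
  have h1 := intervalIntegral_tendsto_integral_Ioi 0 (integrableOn_fract_mul_fract_div_sq p q)
    (tendsto_natCast_atTop_atTop (R := ℝ))
  have h2 := (tendsto_master_rhs hp hq hpq).congr' (by
    filter_upwards [Filter.eventually_ge_atTop 1] with M hM
    exact (integral_fract_mul_fract_eq hp hq hpq (by omega)).symm)
  exact tendsto_nhds_unique h1 h2

end Vasyunin

open Vasyunin in
/-- **BBLS 2003 Prop. 89 = Vasyunin's formula, DISCHARGED:** for coprime positive integers `p, q` and `λ = p/q`,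
`A(λ) = (1−λ)/2·log λ + (λ+1)/2·(log 2π − γ) − (π/(2q))·(V(p,q) + V(q,p))` — the named fact
`Literature.NumberTheory.LFunctions.BBLS2003_prop89` (arXiv:math/0306251 Prop. 89; Vasyunin 1996) is a theorem (the EXACT-name discharge is the last Part).
[cite: BBLS2003AutocorrelationNotes, Prop. 89 (Vasyunin 1996): A(p/q) = (1−λ)/2·log λ + (λ+1)/2·(log 2π − γ) − (π/(2q))(V(p,q)+V(q,p)) — step 3: the limit M → ∞ (Stirling, H_n − log n → γ, cotangent partial fractions)] -/
theorem bbls2003_prop89_holds : BBLS2003_prop89 := by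
  unfold BBLS2003_prop89
  intro p q hp hq hpq
  have hp' : (0 : ℝ) < p := by exact_mod_cast hp
  have hq' : (0 : ℝ) < q := by exact_mod_cast hq
  have hq0 : (q : ℝ) ≠ 0 := hq'.ne'
  rw [fractAutocorr_div_eq p hq, integral_Ioi_fract_mul_fract_div_sq hp hq hpq,
    Real.log_div hp'.ne' hq'.ne', Real.log_mul two_ne_zero Real.pi_pos.ne']
  have hV1 : vasyuninCotSum ((p : ℕ) : ℤ) q =
      ∑ r ∈ Finset.Ico 1 q, Int.fract ((p : ℝ) * r / q) * Real.cot (Real.pi * ((r : ℝ) / q)) := by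
    unfold vasyuninCotSum
    refine Finset.sum_congr rfl fun r _ => ?_
    push_cast
    congr 1 <;> congr 1 <;> ring
  have hV2 : vasyuninCotSum ((q : ℕ) : ℤ) p =
      ∑ j ∈ Finset.Ico 1 p, Int.fract ((q : ℝ) * j / p) * Real.cot (Real.pi * ((j : ℝ) / p)) := by
    unfold vasyuninCotSum
    refine Finset.sum_congr rfl fun j _ => ?_
    push_cast
    congr 1 <;> congr 1 <;> ring
  rw [hV1, hV2]
  field_simp

end Literature.NumberTheory.LFunctions.NymanBeurling

end Part3

/-! ## Part 4 — the EXACT discharges `BBLS2003_prop89_holds`, `BBLS2003_prop87_holds` -/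

namespace Literature.NumberTheory.LFunctions

/-- **The named fact `BBLS2003_prop89` HOLDS (Vasyunin's formula)** — `FractionalPartAutocorrelation.lean`: for coprime positive
integers `p, q` and `λ = p/q`, `A(λ) = (1−λ)/2 · log λ + (λ+1)/2 · (log 2π − γ) − (π/(2q))·(V(p,q) + V(q,p))`.  EXACT-name
restatement of `NymanBeurling.bbls2003_prop89_holds` (Part 3), Literature-side twin of
`Summit.RiemannHypothesis.RiemannHypothesis.Theorems.NbTheory.bbls2003_prop89_holds` (same proof).
[cite: BBLS2003AutocorrelationNotes, Prop. 89] [cite: Vasyunin1996, Theorem (the cotangent-sum formula for the Gram matrix)] -/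
theorem BBLS2003_prop89_holds : BBLS2003_prop89 := NymanBeurling.bbls2003_prop89_holds

/-- **The named fact `BBLS2003_prop87` HOLDS: `A(1) = log 2π − γ`** — `FractionalPartAutocorrelation.lean`, Prop. 87
(printed proof: `∫_0^∞ {t}² t⁻² dt = ∫_0^1 t²ψ′(t) dt = log 2π − γ`).  Here it is the case `p = q = 1` of Vasyunin's formula
(Prop. 89, previous theorem): `λ = 1`, `log 1 = 0`, and both cotangent sums `V(1,1)` are empty.  EXACT discharge (the tree's
other proof, via Farey cells and Stirling, is the Summits-side `Summit.RiemannHypothesis.RiemannHypothesis.Theorems.NbTheory.nbGram_zero_zero`).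
[cite: BBLS2003AutocorrelationNotes, Prop. 87] -/
theorem BBLS2003_prop87_holds : BBLS2003_prop87 := by
  unfold BBLS2003_prop87
  have h := BBLS2003_prop89_holds 1 1 one_pos one_pos (Nat.coprime_one_right 1)
  have hV : vasyuninCotSum ((1 : ℕ) : ℤ) 1 = 0 := by
    unfold vasyuninCotSum
    simp
  rw [hV] at h
  simpa using h

end Literature.NumberTheory.LFunctions

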